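import Mathlib
import Summits.Ventures.PercRepro2.KPrimeReduction
import Summits.Ventures.PercRepro2.KPrimeSure

/-!
# The one-edge Bernstein split of the `(K′)` form (blind cell PercRepro2, mine-c g42;
`conjectures/MINE-C.md` §51)

Fix an edge `e` of weight `t = p e`.  By the pinning identity `prob_eq_pin`, every one of the
ten masses of the cleared form `kprimeForm` is affine in `t`:
`m(t) = (1 − t) · m⁰ + t · m¹`, with `m⁰ = m(p[e ↦ 0])` (the edge deleted) and
`m¹ = m(p[e ↦ 1])` (the edge contracted).  The form is a sum of six products of three masses
(`kformTri`, trilinear in its three slots), so as a polynomial in `t` it is a cubic whose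
Bernstein expansion is

  `kprimeForm(p) = (1 − t)³ · F₀ + t (1 − t)² · G₁ + t² (1 − t) · G₂ + t³ · F₁`,

`F₀ = kprimeForm(p[e ↦ 0])`, `F₁ = kprimeForm(p[e ↦ 1])`, and the MIXED-WORLD forms
`G₁ = Σ kformTri` over the three choices of ONE slot in world `1`, `G₂` the same with TWO slots
in world `1` (`kprimeForm_bernstein_split`).  Consequently `(K′)` at `p` follows from `(K′)` at
the two resolved weight vectors together with `0 ≤ G₁` and `0 ≤ G₂` — the one-edge case of the
tensor-Bernstein non-negativity (TB) of `MINE-C.md` §51.0 (`kprime_of_bernstein_step`); the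
mixed-world inequalities `BernsteinStepHolds` are what a proof of `(K′)` by resolving the edges
one at a time has to supply (the census of §51: 0 negative coefficients at every edge of every
marked graph on ≤ 6 vertices tested).
-/

namespace Summit.Ventures.PercRepro2

namespace KPrime

variable {V : Type*} {E : Type*} [Fintype E] [DecidableEq E] [DecidableEq V]
  {R : Type*} [Field R] [LinearOrder R] [IsStrictOrderedRing R]

section Masses

variable (ends : E → Sym2 V) (a₁ a₂ b v y : V) (p : E → R)

/-- The ten masses of the cleared `(K′)` form, in the order of `kprimeForm`:
`0 = P(U∩X∩Ω)`, `1 = P(U∩Ω)`, `2 = P(N) = D₀`, `3 = P(X∩N) = N₀`, `4 = P(Y∩S)`, `5 = P(S)`,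
`6 = P((0,1)ᵉ)`, `7 = P((0,1))`, `8 = P(U∩Y∩X∩Ω)`, `9 = P(U∩Y∩Ω)`. -/
noncomputable def kmasses : Fin 10 → R
  | 0 => prob p (connEvent ends a₁ v ∩ connEvent ends a₁ b ∩ Ω ends a₁ a₂)
  | 1 => prob p (connEvent ends a₁ v ∩ Ω ends a₁ a₂)
  | 2 => prob p (N ends a₁ a₂ v)
  | 3 => prob p (connEvent ends a₁ b ∩ N ends a₁ a₂ v)
  | 4 => prob p (connEvent ends a₂ y ∩ S ends a₁ a₂ v)
  | 5 => prob p (S ends a₁ a₂ v)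
  | 6 => prob p (cls01e ends a₁ a₂ b v y)
  | 7 => prob p (cls01 ends a₁ a₂ v y)
  | 8 => prob p (connEvent ends a₁ v ∩ connEvent ends a₂ y ∩ connEvent ends a₁ b ∩ Ω ends a₁ a₂)
  | 9 => prob p (connEvent ends a₁ v ∩ connEvent ends a₂ y ∩ Ω ends a₁ a₂)

end Masses

section Trilinear

/-- The `(K′)` form as a trilinear function of three mass vectors (first, second, third factor of
each of its six products): `kformTri M M M` is the cleared form at the masses `M`. -/
def kformTri (A B C : Fin 10 → R) : R :=
  A 0 * B 2 * C 4 - A 3 * B 1 * C 4 + A 5 * B 6 * C 2 - A 5 * B 3 * C 7 - A 5 * B 8 * C 2 +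
    A 5 * B 3 * C 9

/-- The mixed-world form with one slot in world `1`. -/
def mixedOne (M₀ M₁ : Fin 10 → R) : R :=
  kformTri M₁ M₀ M₀ + kformTri M₀ M₁ M₀ + kformTri M₀ M₀ M₁

/-- The mixed-world form with two slots in world `1`. -/
def mixedTwo (M₀ M₁ : Fin 10 → R) : R :=
  kformTri M₁ M₁ M₀ + kformTri M₁ M₀ M₁ + kformTri M₀ M₁ M₁

/-- The affine mixture of two mass vectors. -/
def mixM (t : R) (M₀ M₁ : Fin 10 → R) : Fin 10 → R := fun k => (1 - t) * M₀ k + t * M₁ k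

omit [Fintype E] [DecidableEq E] [DecidableEq V] [LinearOrder R] [IsStrictOrderedRing R] in
/-- **The Bernstein split** of the cubic `kformTri` along an affine mixture of its argument. -/
lemma kformTri_mix (t : R) (M₀ M₁ : Fin 10 → R) :
    kformTri (mixM t M₀ M₁) (mixM t M₀ M₁) (mixM t M₀ M₁) =
      (1 - t) ^ 3 * kformTri M₀ M₀ M₀ + t * (1 - t) ^ 2 * mixedOne M₀ M₁ +
        t ^ 2 * (1 - t) * mixedTwo M₀ M₁ + t ^ 3 * kformTri M₁ M₁ M₁ := by
  simp only [kformTri, mixedOne, mixedTwo, mixM]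
  ring

end Trilinear

section Split

variable (ends : E → Sym2 V) (a₁ a₂ b v y : V) (p : E → R)

omit [LinearOrder R] [IsStrictOrderedRing R] in
/-- The cleared form at its own lean `N₀ = P(X ∩ N)`, `D₀ = P(N)` is the cubic `kformTri` of the
mass vector. -/
lemma kprimeForm_eq_kformTri :
    kprimeForm ends a₁ a₂ b v y p (prob p (connEvent ends a₁ b ∩ N ends a₁ a₂ v))
        (prob p (N ends a₁ a₂ v)) =
      kformTri (kmasses ends a₁ a₂ b v y p) (kmasses ends a₁ a₂ b v y p)
        (kmasses ends a₁ a₂ b v y p) := by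
  simp only [kprimeForm, kformTri, kmasses]
  ring

omit [LinearOrder R] [IsStrictOrderedRing R] in
/-- **Pinning the edge `e`**: the mass vector at `p` is the affine mixture, with `t = p e`, of the
mass vectors at `p[e ↦ 0]` (deleted) and `p[e ↦ 1]` (contracted). -/
lemma kmasses_eq_mix (e : E) :
    kmasses ends a₁ a₂ b v y p =
      mixM (p e) (kmasses ends a₁ a₂ b v y (Function.update p e 0))
        (kmasses ends a₁ a₂ b v y (Function.update p e 1)) := by
  funext k
  fin_cases k <;> simp only [kmasses, mixM] <;> rw [prob_eq_pin p _ e] <;> ring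

omit [LinearOrder R] [IsStrictOrderedRing R] in
/-- **The one-edge Bernstein split of the `(K′)` form**: with `t = p e`,
`kprimeForm(p) = (1 − t)³ F₀ + t (1 − t)² G₁ + t² (1 − t) G₂ + t³ F₁`. -/
theorem kprimeForm_bernstein_split (e : E) :
    kprimeForm ends a₁ a₂ b v y p (prob p (connEvent ends a₁ b ∩ N ends a₁ a₂ v))
        (prob p (N ends a₁ a₂ v)) =
      (1 - p e) ^ 3 * kprimeForm ends a₁ a₂ b v y (Function.update p e 0)
          (prob (Function.update p e 0) (connEvent ends a₁ b ∩ N ends a₁ a₂ v))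
          (prob (Function.update p e 0) (N ends a₁ a₂ v)) +
        p e * (1 - p e) ^ 2 * mixedOne (kmasses ends a₁ a₂ b v y (Function.update p e 0))
          (kmasses ends a₁ a₂ b v y (Function.update p e 1)) +
        (p e) ^ 2 * (1 - p e) * mixedTwo (kmasses ends a₁ a₂ b v y (Function.update p e 0))
          (kmasses ends a₁ a₂ b v y (Function.update p e 1)) +
        (p e) ^ 3 * kprimeForm ends a₁ a₂ b v y (Function.update p e 1)
          (prob (Function.update p e 1) (connEvent ends a₁ b ∩ N ends a₁ a₂ v))
          (prob (Function.update p e 1) (N ends a₁ a₂ v)) := by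
  rw [kprimeForm_eq_kformTri, kprimeForm_eq_kformTri, kprimeForm_eq_kformTri,
    kmasses_eq_mix ends a₁ a₂ b v y p e, kformTri_mix]

/-- **The one-edge (TB) condition** at the edge `e`: the two mixed-world forms of the Bernstein
split are non-negative. -/
def BernsteinStepHolds (e : E) : Prop :=
  0 ≤ mixedOne (kmasses ends a₁ a₂ b v y (Function.update p e 0))
      (kmasses ends a₁ a₂ b v y (Function.update p e 1)) ∧
    0 ≤ mixedTwo (kmasses ends a₁ a₂ b v y (Function.update p e 0))
      (kmasses ends a₁ a₂ b v y (Function.update p e 1))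

/-- **`(K′)` from the two resolved instances and the one-edge (TB) condition**: if `(K′)` holds
with `e` deleted and with `e` contracted, and the mixed-world forms at `e` are non-negative, then
`(K′)` holds at `p` (every weight `p e ∈ [0, 1]`). -/
theorem kprime_of_bernstein_step (hp : IsProbVec p) (e : E)
    (h0 : KPrimeHolds ends a₁ a₂ b v y (Function.update p e 0))
    (h1 : KPrimeHolds ends a₁ a₂ b v y (Function.update p e 1))
    (hB : BernsteinStepHolds ends a₁ a₂ b v y p e) :
    KPrimeHolds ends a₁ a₂ b v y p := by
  unfold KPrimeHolds at h0 h1 ⊢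
  rw [kprimeForm_bernstein_split ends a₁ a₂ b v y p e]
  obtain ⟨hG1, hG2⟩ := hB
  have ht0 : 0 ≤ p e := hp.nonneg e
  have ht1 : 0 ≤ 1 - p e := sub_nonneg.2 (hp.le_one e)
  positivity

end Split

end KPrime

end Summit.Ventures.PercRepro2
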